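import Summits.Ventures.CertifiedManyBodySolver.Downfold.ParameterBox
import HarnessLib

/-!
# Joining determination boxes: coordinatewise hull in which an absent entry abstains

Venture CertifiedManyBodySolver, cell `pub/hubbard-downfold` (stage S1 = downfolding front end), seat
hubbard-downfold-mod-4; namespace `Summit.Ventures.CertifiedManyBodySolver.Downfold`. Everything here
is PROVED. WHAT THIS IS NOT: a statement about any material.

The one-band box of record is assembled from several DETERMINATION boxes (direct one-band Wannier
fits and one-band cRPA `U`, technique A = cell perturbation, technique B = band matching, referee
re-runs): per coordinate the HULL of every determination present (cell ROUTER v0.5 §4.3 BOX-WIDTH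
ALGEBRA (1), `router/BOX-SCHEMA.md` R2: «INFL axes are hulled in as determinations, never summed»).
mod-1's `Box.hull` (`Downfold.ParameterBox`) makes a coordinate undetermined as soon as ONE source
leaves it undetermined (right for two sources that must both cover); for determinations an absent
entry means the source ABSTAINS and the other entries stand:

* `Box.join B C` — both present ⇒ `Entry.hull`; one present ⇒ that entry; none ⇒ undetermined.
* `Box.mem_join` — per-coordinate DISJUNCTIVE trust: if at every coordinate at least one source
  present there encloses `p i`, the join encloses `p` (from `Entry.mem_hull_of_or`).
* `Box.refines_join_left/right` — a source refines the join when the other source's support lies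
  inside its own (joining only WIDENS it there), so `HoldsOn.of_refines` transports words certified
  on the join back to it (inflation safety).
-/

namespace Summit.Ventures.CertifiedManyBodySolver.Downfold

open NonemptyInterval

namespace Box

variable {ι : Type*}

/-- **Join of two determination boxes** (BOX-WIDTH ALGEBRA, ROUTER v0.5 §4.3 (1)): per coordinate
the hull of the two entries when both sources determine it, the single entry when only one does,
undetermined when neither does. [folklore] -/
def join (B C : Box ι) : Box ι := fun i =>
  match B i, C i with
  | some e, some f => some (e.hull f)
  | some e, none => some e
  | none, some f => some f
  | none, none => none

/-- **Join rule (per-coordinate disjunctive trust)**: if at every coordinate at least one of the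
sources PRESENT there encloses `p i`, the join encloses `p`. [folklore] -/
theorem mem_join {B C : Box ι} {p : ι → ℝ}
    (h : ∀ i, (∃ e, B i = some e ∧ e.Mem (p i)) ∨ (∃ f, C i = some f ∧ f.Mem (p i)) ∨
      (B i = none ∧ C i = none)) : (B.join C).Mem p := by
  intro i g hg
  unfold join at hg
  rcases h i with ⟨e, he, hem⟩ | ⟨f, hf, hfm⟩ | ⟨hB, hC⟩
  · rw [he] at hg
    cases hC : C i with
    | none => rw [hC] at hg; simp only [Option.some.injEq] at hg; subst hg; exact hem
    | some f =>
      rw [hC] at hg; simp only [Option.some.injEq] at hg; subst hg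
      exact Entry.mem_hull_of_or (Or.inl hem)
  · rw [hf] at hg
    cases hB : B i with
    | none => rw [hB] at hg; simp only [Option.some.injEq] at hg; subst hg; exact hfm
    | some e =>
      rw [hB] at hg; simp only [Option.some.injEq] at hg; subst hg
      exact Entry.mem_hull_of_or (Or.inr hfm)
  · rw [hB, hC] at hg; simp at hg

/-- Joining a source whose support lies inside the first source's support only WIDENS the first
box (so a word certified on the join holds on it: `HoldsOn.of_refines`). [folklore] -/
theorem refines_join_left {B C : Box ι} (hCB : ∀ i, B i = none → C i = none) :
    B.Refines (B.join C) := by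
  intro p hp
  refine mem_join fun i => ?_
  cases hB : B i with
  | none => exact Or.inr (Or.inr ⟨rfl, hCB i hB⟩)
  | some e => exact Or.inl ⟨e, rfl, hp i e hB⟩

/-- Symmetric form: the second source refines the join when its support contains the first's.
[folklore] -/
theorem refines_join_right {B C : Box ι} (hBC : ∀ i, C i = none → B i = none) :
    C.Refines (B.join C) := by
  intro p hp
  refine mem_join fun i => ?_
  cases hC : C i with
  | none => exact Or.inr (Or.inr ⟨hBC i hC, rfl⟩)
  | some f => exact Or.inr (Or.inl ⟨f, rfl, hp i f hC⟩)

end Box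

end Summit.Ventures.CertifiedManyBodySolver.Downfold
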